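import Summits.CriticalPhenomena.PercolationContinuityZ3.Theorems.Transplant.FKConnectivityAllQForestSeparatorExchange
import Summits.CriticalPhenomena.PercolationContinuityZ3.Theorems.Transplant.FKConnectivityAllQForestAdjacentEdgeSeparator
import HarnessLib

/-!
# The square-free adjacent forest node is an EQUALITY across any separator with the trace dichotomy

builds on p205010 (kernel theorem, internal audit signed; external expert review pending).  No definitions, no named facts, no sorries;
standard axioms.

The GENERAL separator transfer theorem for the node `FK.AdjForestRayleighNoSqOn` (`…TwoClusterRayleighNoSq.lean`; vertex form: for a
uniform ordered pair `(A, B)` of edge-disjoint forests of `G'` with union `E(G')`, `P(e, f same colour) ≤ 1/2` for adjacent `e = ov`,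
`f = oy`), memo bschramm/FROM-fk-1-g19-ADVERSARIAL.md §2f(v) and FK-DEFS §24 (gen 20).

Set-up: sides `E₁` (pairs on `V₁`, `e ∈ E₁`), `E₂` (pairs on `V₂`, `f ∈ E₂`) and a gadget `ES` (pairs inside `S`), `V₁ ∩ V₂ ⊆ S`, the
three pairwise disjoint; the fibre `(M', u₀)` has all its pairs in `ES ∪ E₁ ∪ E₂`.  The TRACE of a configuration on `S` is its
reachability relation restricted to `S`.  TRACE DICHOTOMY: in every valid colouring `(ω, ω ∆ M')` of the fibre, the two side-2 classes
`ω ∩ E₂`, `(ω ∆ M') ∩ E₂` have the same trace on `S`, OR the two side-1 classes `ω ∩ E₁`, `(ω ∆ M') ∩ E₁` do.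
* `isForestCfg_glue₂_of_trace` / `isForestCfg_glue₁_of_trace` — the exchange step (`…ForestSeparatorExchange`) in the three-part
  geometry: (gadget + side 1 of a forest `X`) ∪ (side 2 of a forest `Y`) is a forest as soon as the side-2 traces of `X` and `Y` agree.
* `forest_pair_transfer_of_sepTrace` — the involution `Φ`: recolour side 2 by its partner if the side-2 traces agree, recolour side 2 AND
  the gadget otherwise (then the side-1 traces agree); validity-preserving, fibre-preserving, fixes side 1, flips the free pairs of side 2.
* **`adjForestNoSq_fibre_eq_of_sepTrace`** — under the trace dichotomy `#(Fo ∩ {e, f ∈ ω}, Fo) = #(Fo ∩ {e ∈ ω}, Fo ∩ {f ∈ ω})`.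
The two known sources of the dichotomy — DENSE separators (`|E(S)| ≥ 2|S| - 3`, every `|S|`) and TIGHT sets (`|E(U)| = 2|U| - 2`) —
are `…ForestAdjacentDenseSeparator`; the special cases `|S| = 1, 2, 3` are p323201, p328146, p329067 (each with its own gadget lemma).
[cite: Grimmett2006, §1.5 (p. 13); §3.8 (pp. 61–62); §4.2 Lemma (4.13)] [cite: SempleWelsh2008, Conj. 1.1 (p. 2)] [cite: Linusson2011, Prop. 2.6]
-/

noncomputable section

namespace Summit.CriticalPhenomena.PercolationContinuityZ3.Theorems

namespace FK

open Set SimpleGraph Literature.Probability.LatticeModels Literature.Probability.Percolation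
open scoped Classical

variable {V : Type*} [Fintype V]

section SepTransfer

open scoped symmDiff

variable {E₁ E₂ ES : Set (Sym2 V)} {V₁ V₂ S : Set V} {M u₀ : BondConfig V} {o v y : V}

omit [Fintype V] in
/-- Equality of traces is symmetric. [folklore] -/
theorem trace_iff_comm {Z Z' : BondConfig V} :
    (∀ x ∈ S, ∀ y' ∈ S, (openGraph Z).Reachable x y' ↔ (openGraph Z').Reachable x y') ↔
      (∀ x ∈ S, ∀ y' ∈ S, (openGraph Z').Reachable x y' ↔ (openGraph Z).Reachable x y') := by
  constructor <;> intro h x hx y' hy' <;> exact (h x hx y' hy').symm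

/-- **Gluing across the separator, side 2 exchanged.**  If `X ⊆ ES ∪ E₁ ∪ E₂` and `Y` are forests and the side-2 parts `X ∩ E₂`,
`Y ∩ E₂` have the same trace on `S`, then `(X ∩ (ES ∪ E₁)) ∪ (Y ∩ E₂)` is a forest (`isForestCfg_union_exchange` with the inside
`V₁ ∪ S` and the rim `S`). [cite: Grimmett2006, §3.8 (pp. 61–62); §4.2 Lemma (4.13)] -/
theorem isForestCfg_glue₂_of_trace (h₁ : ∀ e ∈ E₁, ∀ z ∈ e, z ∈ V₁) (h₂ : ∀ e ∈ E₂, ∀ z ∈ e, z ∈ V₂)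
    (hES : ∀ e ∈ ES, ∀ z ∈ e, z ∈ S) (hS : V₁ ∩ V₂ ⊆ S) (hd : Disjoint E₁ E₂) (hd₂ : Disjoint ES E₂)
    {X Y : BondConfig V} (hXsub : X ⊆ ES ∪ (E₁ ∪ E₂)) (hX : IsForestCfg X) (hY : IsForestCfg Y)
    (htr : ∀ x ∈ S, ∀ y' ∈ S, (openGraph (X ∩ E₂)).Reachable x y' ↔ (openGraph (Y ∩ E₂)).Reachable x y') :
    IsForestCfg (X ∩ (ES ∪ E₁) ∪ Y ∩ E₂) := by
  have hsplit : X ∩ (ES ∪ E₁) ∪ X ∩ E₂ = X := by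
    rw [← inter_union_distrib_left, union_assoc]; exact inter_eq_self_of_subset_left hXsub
  have hU : ∀ e ∈ X ∩ (ES ∪ E₁), ∀ z ∈ e, z ∈ V₁ ∪ S := by
    rintro e ⟨-, he | he⟩ z hz
    · exact Or.inr (hES e he z hz)
    · exact Or.inl (h₁ e he z hz)
  have hrim : ∀ (T : BondConfig V), ∀ e ∈ T ∩ E₂, ∀ z ∈ e, z ∈ V₁ ∪ S → z ∈ S := by
    rintro T e ⟨-, he⟩ z hz (hz1 | hz1)
    · exact hS ⟨hz1, h₂ e he z hz⟩
    · exact hz1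
  have hdisj : ∀ (T : BondConfig V), Disjoint (X ∩ (ES ∪ E₁)) (T ∩ E₂) := by
    intro T
    refine Set.disjoint_left.2 ?_
    rintro x ⟨-, hx | hx⟩ ⟨-, hx2⟩
    · exact Set.disjoint_left.1 hd₂ hx hx2
    · exact Set.disjoint_left.1 hd hx hx2
  exact isForestCfg_union_exchange (W := S) (X := V₁ ∪ S) hU (hrim X) (hrim Y) htr (hdisj X) (hdisj Y) (hsplit.symm ▸ hX)
    (isForestCfg_of_subset hY inter_subset_left)

/-- **Gluing across the separator, side 1 exchanged** (the mirror statement: the gadget travels with side 2).  If `X ⊆ ES ∪ E₁ ∪ E₂` and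
`Y` are forests and the side-1 parts `X ∩ E₁`, `Y ∩ E₁` have the same trace on `S`, then `(X ∩ (ES ∪ E₂)) ∪ (Y ∩ E₁)` is a forest.
[cite: Grimmett2006, §3.8 (pp. 61–62); §4.2 Lemma (4.13)] -/
theorem isForestCfg_glue₁_of_trace (h₁ : ∀ e ∈ E₁, ∀ z ∈ e, z ∈ V₁) (h₂ : ∀ e ∈ E₂, ∀ z ∈ e, z ∈ V₂)
    (hES : ∀ e ∈ ES, ∀ z ∈ e, z ∈ S) (hS : V₁ ∩ V₂ ⊆ S) (hd : Disjoint E₁ E₂) (hd₁ : Disjoint ES E₁)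
    {X Y : BondConfig V} (hXsub : X ⊆ ES ∪ (E₁ ∪ E₂)) (hX : IsForestCfg X) (hY : IsForestCfg Y)
    (htr : ∀ x ∈ S, ∀ y' ∈ S, (openGraph (X ∩ E₁)).Reachable x y' ↔ (openGraph (Y ∩ E₁)).Reachable x y') :
    IsForestCfg (X ∩ (ES ∪ E₂) ∪ Y ∩ E₁) := by
  have hXsub' : X ⊆ ES ∪ (E₂ ∪ E₁) := by rw [union_comm E₂ E₁]; exact hXsub
  have hS' : V₂ ∩ V₁ ⊆ S := by rw [inter_comm]; exact hS
  exact isForestCfg_glue₂_of_trace (V₁ := V₂) (V₂ := V₁) h₂ h₁ hES hS' hd.symm hd₁ hXsub' hX hY htr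

/-- **The transfer step across an arbitrary separator under the trace dichotomy** (memo bschramm/FROM-fk-1-g19-ADVERSARIAL.md §2f(v),
general `S`).  Sides `E₁` (pairs on `V₁`), `E₂` (pairs on `V₂`), gadget `ES` (pairs inside `S`), `V₁ ∩ V₂ ⊆ S`, the three pairwise
disjoint; the fibre `(M', u₀)` has its pairs in `ES ∪ E₁ ∪ E₂`.  HYPOTHESIS (trace dichotomy): in every valid colouring `(ω, ω ∆ M')` of
the fibre, the two side-2 classes have the same trace on `S` OR the two side-1 classes have the same trace on `S`.  Let
`N₀ = M' ∩ E₂`, `N₁ = M' ∩ (ES ∪ E₂)`; `Φ ω = ω ∆ N₀` (recolour side 2 by its partner) if the side-2 traces agree, `Φ ω = ω ∆ N₁`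
(recolour side 2 AND the gadget) otherwise.  Then `Φ` maps valid colourings to valid colourings of the same fibre, is an involution,
keeps side 1 and flips the free pairs of side 2.  Validity is the forest exchange `isForestCfg_union_exchange`: a side glued onto a
forest sees only its trace. [cite: Grimmett2006, §3.8 (pp. 61–62); §4.2 Lemma (4.13)] [cite: Linusson2011, Prop. 2.6] -/
theorem forest_pair_transfer_of_sepTrace (h₁ : ∀ e ∈ E₁, ∀ z ∈ e, z ∈ V₁) (h₂ : ∀ e ∈ E₂, ∀ z ∈ e, z ∈ V₂)
    (hES : ∀ e ∈ ES, ∀ z ∈ e, z ∈ S) (hS : V₁ ∩ V₂ ⊆ S)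
    (hd : Disjoint E₁ E₂) (hd₁ : Disjoint ES E₁) (hd₂ : Disjoint ES E₂) {M' : BondConfig V}
    (hM' : M' ∪ u₀ ⊆ ES ∪ (E₁ ∪ E₂))
    (hH : ∀ ω : BondConfig V, ω \ M' = u₀ → IsForestCfg ω → IsForestCfg (ω ∆ M') →
      (∀ x ∈ S, ∀ y' ∈ S, (openGraph (ω ∩ E₂)).Reachable x y' ↔ (openGraph ((ω ∆ M') ∩ E₂)).Reachable x y') ∨
      (∀ x ∈ S, ∀ y' ∈ S, (openGraph (ω ∩ E₁)).Reachable x y' ↔ (openGraph ((ω ∆ M') ∩ E₁)).Reachable x y'))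
    (Φ : BondConfig V → BondConfig V)
    (hΦ : ∀ ω, Φ ω = if (∀ x ∈ S, ∀ y' ∈ S, (openGraph (ω ∩ E₂)).Reachable x y' ↔ (openGraph ((ω ∆ M') ∩ E₂)).Reachable x y')
      then ω ∆ (M' ∩ E₂) else ω ∆ (M' ∩ (ES ∪ E₂)))
    {ω : BondConfig V} (hω : ω \ M' = u₀) (hF : IsForestCfg ω) (hFB : IsForestCfg (ω ∆ M')) :
    Φ ω \ M' = u₀ ∧ IsForestCfg (Φ ω) ∧ IsForestCfg ((Φ ω) ∆ M') ∧ Φ (Φ ω) = ω ∧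
      (∀ x ∈ E₁, x ∈ Φ ω ↔ x ∈ ω) ∧ (∀ x ∈ M', x ∈ E₂ → (x ∈ Φ ω ↔ x ∉ ω)) := by
  set N₀ : BondConfig V := M' ∩ E₂ with hN₀
  set N₁ : BondConfig V := M' ∩ (ES ∪ E₂) with hN₁
  have hn₁ : ∀ g ∈ ES, g ∉ E₁ := fun g hg h => Set.disjoint_left.1 hd₁ hg h
  have hn₂ : ∀ g ∈ ES, g ∉ E₂ := fun g hg h => Set.disjoint_left.1 hd₂ hg h
  have hE : ∀ x, x ∈ E₁ → x ∉ E₂ := fun x hx1 hx2 => Set.disjoint_left.1 hd hx1 hx2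
  -- where the configurations live
  have hM'sub : M' ⊆ ES ∪ (E₁ ∪ E₂) := fun x hx => hM' (Or.inl hx)
  have hωsub : ω ⊆ ES ∪ (E₁ ∪ E₂) := fun x hx => by
    by_cases hxM : x ∈ M'
    · exact hM'sub hxM
    · exact hM' (Or.inr (hω ▸ ⟨hx, hxM⟩))
  have hsd : ∀ {X N : BondConfig V}, X ⊆ ES ∪ (E₁ ∪ E₂) → N ⊆ M' → X ∆ N ⊆ ES ∪ (E₁ ∪ E₂) := by
    intro X N hX hN x hx
    rw [Set.mem_symmDiff] at hx
    rcases hx with ⟨hx, -⟩ | ⟨hx, -⟩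
    · exact hX hx
    · exact hM'sub (hN hx)
  have hωBsub : ω ∆ M' ⊆ ES ∪ (E₁ ∪ E₂) := hsd hωsub subset_rfl
  -- splitting a configuration into (gadget + one side) and (other side)
  have split₂ : ∀ {X : BondConfig V}, X ⊆ ES ∪ (E₁ ∪ E₂) → X ∩ (ES ∪ E₁) ∪ X ∩ E₂ = X := fun hX => by
    rw [← inter_union_distrib_left, union_assoc]; exact inter_eq_self_of_subset_left hX
  have split₁ : ∀ {X : BondConfig V}, X ⊆ ES ∪ (E₁ ∪ E₂) → X ∩ (ES ∪ E₂) ∪ X ∩ E₁ = X := fun hX => by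
    rw [← inter_union_distrib_left, union_assoc, union_comm E₂ E₁]; exact inter_eq_self_of_subset_left hX
  -- the two recolouring sets
  have hN₀M : N₀ ⊆ M' := inter_subset_left
  have hN₁M : N₁ ⊆ M' := inter_subset_left
  have hN₀out : ∀ x ∈ N₀, x ∉ ES ∪ E₁ := by
    rintro x ⟨-, hx2⟩ (hx | hx)
    · exact hn₂ x hx hx2
    · exact hE x hx hx2
  have hN₁out : ∀ x ∈ N₁, x ∉ E₁ := by
    rintro x ⟨-, hx | hx⟩ hx1
    · exact hn₁ x hx hx1
    · exact hE x hx1 hx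
  have hMN₀ : ∀ x ∈ M', x ∈ E₂ → x ∈ N₀ := fun x hx hx2 => ⟨hx, hx2⟩
  have hMN₁ : ∀ x ∈ M', x ∈ ES ∪ E₂ → x ∈ N₁ := fun x hx hx2 => ⟨hx, hx2⟩
  have hMN₁' : ∀ x ∈ M', x ∈ E₂ → x ∈ N₁ := fun x hx hx2 => ⟨hx, Or.inr hx2⟩
  have hN₀E₁ : ∀ x ∈ N₀, x ∉ E₁ := fun x hx hx1 => hN₀out x hx (Or.inr hx1)
  by_cases hQ : ∀ x ∈ S, ∀ y' ∈ S, (openGraph (ω ∩ E₂)).Reachable x y' ↔ (openGraph ((ω ∆ M') ∩ E₂)).Reachable x y'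
  · -- the side-2 traces agree: recolour side 2 only
    have hΦω : Φ ω = ω ∆ N₀ := by rw [hΦ ω, if_pos hQ]
    have hT1 : (ω ∆ N₀) ∩ (ES ∪ E₁) = ω ∩ (ES ∪ E₁) := symmDiff_inter_eq_of_disjoint hN₀out
    have hT2 : (ω ∆ N₀) ∩ E₂ = (ω ∆ M') ∩ E₂ := symmDiff_inter_eq_partner hN₀M hMN₀
    have hT3 : ((ω ∆ N₀) ∆ M') ∩ (ES ∪ E₁) = (ω ∆ M') ∩ (ES ∪ E₁) := symmDiff_symmDiff_inter_eq_partner hN₀M hN₀out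
    have hT4 : ((ω ∆ N₀) ∆ M') ∩ E₂ = ω ∩ E₂ := symmDiff_symmDiff_inter_eq_self hN₀M hMN₀
    have hval₁ : IsForestCfg (ω ∆ N₀) := by
      rw [← split₂ (hsd hωsub hN₀M), hT1, hT2]
      exact isForestCfg_glue₂_of_trace h₁ h₂ hES hS hd hd₂ hωsub hF hFB hQ
    have hval₂ : IsForestCfg ((ω ∆ N₀) ∆ M') := by
      rw [← split₂ (hsd (hsd hωsub hN₀M) subset_rfl), hT3, hT4]
      exact isForestCfg_glue₂_of_trace h₁ h₂ hES hS hd hd₂ hωBsub hFB hF (trace_iff_comm.1 hQ)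
    have hQ' : ∀ x ∈ S, ∀ y' ∈ S, (openGraph ((ω ∆ N₀) ∩ E₂)).Reachable x y' ↔
        (openGraph (((ω ∆ N₀) ∆ M') ∩ E₂)).Reachable x y' := by
      rw [hT2, hT4]; exact trace_iff_comm.1 hQ
    refine ⟨by rw [hΦω, symmDiff_sdiff_eq_of_subset hN₀M, hω], hΦω ▸ hval₁, hΦω ▸ hval₂, ?_,
      fun x hx => by rw [hΦω]; exact mem_symmDiff_iff_of_notMem (fun h => hN₀E₁ x h hx),
      fun x hxM hx2 => by rw [hΦω]; exact mem_symmDiff_iff_of_mem (hMN₀ x hxM hx2)⟩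
    rw [hΦω, hΦ (ω ∆ N₀), if_pos hQ']
    exact symmDiff_symmDiff_cancel_right _ _
  · -- the side-2 traces differ: the side-1 traces agree (dichotomy); recolour side 2 AND the gadget
    have hΦω : Φ ω = ω ∆ N₁ := by rw [hΦ ω, if_neg hQ]
    have hP₁ : ∀ x ∈ S, ∀ y' ∈ S, (openGraph (ω ∩ E₁)).Reachable x y' ↔ (openGraph ((ω ∆ M') ∩ E₁)).Reachable x y' :=
      (hH ω hω hF hFB).resolve_left hQ
    have hT1 : (ω ∆ N₁) ∩ E₁ = ω ∩ E₁ := symmDiff_inter_eq_of_disjoint hN₁out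
    have hT2 : (ω ∆ N₁) ∩ (ES ∪ E₂) = (ω ∆ M') ∩ (ES ∪ E₂) := symmDiff_inter_eq_partner hN₁M hMN₁
    have hT2' : (ω ∆ N₁) ∩ E₂ = (ω ∆ M') ∩ E₂ := symmDiff_inter_eq_partner hN₁M hMN₁'
    have hT3 : ((ω ∆ N₁) ∆ M') ∩ E₁ = (ω ∆ M') ∩ E₁ := symmDiff_symmDiff_inter_eq_partner hN₁M hN₁out
    have hT4 : ((ω ∆ N₁) ∆ M') ∩ (ES ∪ E₂) = ω ∩ (ES ∪ E₂) := symmDiff_symmDiff_inter_eq_self hN₁M hMN₁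
    have hT4' : ((ω ∆ N₁) ∆ M') ∩ E₂ = ω ∩ E₂ := symmDiff_symmDiff_inter_eq_self hN₁M hMN₁'
    have hval₁ : IsForestCfg (ω ∆ N₁) := by
      rw [← split₁ (hsd hωsub hN₁M), hT1, hT2]
      exact isForestCfg_glue₁_of_trace h₁ h₂ hES hS hd hd₁ hωBsub hFB hF (trace_iff_comm.1 hP₁)
    have hval₂ : IsForestCfg ((ω ∆ N₁) ∆ M') := by
      rw [← split₁ (hsd (hsd hωsub hN₁M) subset_rfl), hT3, hT4]
      exact isForestCfg_glue₁_of_trace h₁ h₂ hES hS hd hd₁ hωsub hF hFB hP₁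
    have hQ' : ¬ ∀ x ∈ S, ∀ y' ∈ S, (openGraph ((ω ∆ N₁) ∩ E₂)).Reachable x y' ↔
        (openGraph (((ω ∆ N₁) ∆ M') ∩ E₂)).Reachable x y' := by
      rw [hT2', hT4', ← trace_iff_comm]; exact hQ
    refine ⟨by rw [hΦω, symmDiff_sdiff_eq_of_subset hN₁M, hω], hΦω ▸ hval₁, hΦω ▸ hval₂, ?_,
      fun x hx => by rw [hΦω]; exact mem_symmDiff_iff_of_notMem (fun h => hN₁out x h hx),
      fun x hxM hx2 => by rw [hΦω]; exact mem_symmDiff_iff_of_mem (hMN₁' x hxM hx2)⟩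
    rw [hΦω, hΦ (ω ∆ N₁), if_neg hQ']
    exact symmDiff_symmDiff_cancel_right _ _

/-- **The node's inequality is an EQUALITY across any separator with the trace dichotomy.**  Fibre `(M ∪ {e, f}, u₀)`, `e = ov ∈ E₁`,
`f = oy ∈ E₂`, sides `E₁` (pairs on `V₁`), `E₂` (pairs on `V₂`), gadget `ES` (pairs inside `S`), `V₁ ∩ V₂ ⊆ S`, the three pairwise
disjoint, all pairs of the fibre in `ES ∪ E₁ ∪ E₂`.  If every valid colouring of the fibre has equal side-2 traces on `S` or equal
side-1 traces on `S`, then `#(Fo ∩ {e, f ∈ ω}, Fo) = #(Fo ∩ {e ∈ ω}, Fo ∩ {f ∈ ω})`, i.e. `P(e, f same colour) = 1/2` exactly.  The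
dense separators (`|E(S)| ≥ 2|S| - 3`, all `|S|`: `…ForestAdjacentDenseSeparator`) and the tight sets (`|E(U)| = 2|U| - 2`) are the two
ways the dichotomy is known to arise; the cases `|S| ≤ 3` are p323201, p328146, p329067. [cite: SempleWelsh2008, Conj. 1.1 (p. 2)]
[cite: Linusson2011, Prop. 2.6] [cite: Grimmett2006, §3.8 (pp. 61–62)] -/
theorem adjForestNoSq_fibre_eq_of_sepTrace (h₁ : ∀ e ∈ E₁, ∀ z ∈ e, z ∈ V₁) (h₂ : ∀ e ∈ E₂, ∀ z ∈ e, z ∈ V₂)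
    (hES : ∀ e ∈ ES, ∀ z ∈ e, z ∈ S) (hS : V₁ ∩ V₂ ⊆ S)
    (hd : Disjoint E₁ E₂) (hd₁ : Disjoint ES E₁) (hd₂ : Disjoint ES E₂) (heE : s(o, v) ∈ E₁) (hfE : s(o, y) ∈ E₂)
    (hsub : insert s(o, y) (insert s(o, v) M) ∪ u₀ ⊆ ES ∪ (E₁ ∪ E₂))
    (hH : ∀ ω : BondConfig V, ω \ insert s(o, y) (insert s(o, v) M) = u₀ → IsForestCfg ω →
      IsForestCfg (ω ∆ insert s(o, y) (insert s(o, v) M)) →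
      (∀ x ∈ S, ∀ y' ∈ S, (openGraph (ω ∩ E₂)).Reachable x y' ↔
        (openGraph ((ω ∆ insert s(o, y) (insert s(o, v) M)) ∩ E₂)).Reachable x y') ∨
      (∀ x ∈ S, ∀ y' ∈ S, (openGraph (ω ∩ E₁)).Reachable x y' ↔
        (openGraph ((ω ∆ insert s(o, y) (insert s(o, v) M)) ∩ E₁)).Reachable x y')) :
    fibreCount (insert s(o, y) (insert s(o, v) M)) u₀ (forestEv V ∩ {ω | s(o, v) ∈ ω ∧ s(o, y) ∈ ω}) (forestEv V) =
      fibreCount (insert s(o, y) (insert s(o, v) M)) u₀ (forestEv V ∩ {ω | s(o, v) ∈ ω}) (forestEv V ∩ {ω | s(o, y) ∈ ω}) := by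
  set M' : BondConfig V := insert s(o, y) (insert s(o, v) M) with hM'
  set Φ : BondConfig V → BondConfig V := fun ω =>
    if (∀ x ∈ S, ∀ y' ∈ S, (openGraph (ω ∩ E₂)).Reachable x y' ↔ (openGraph ((ω ∆ M') ∩ E₂)).Reachable x y')
      then ω ∆ (M' ∩ E₂) else ω ∆ (M' ∩ (ES ∪ E₂)) with hΦdef
  have hΦ : ∀ ω, Φ ω =
      if (∀ x ∈ S, ∀ y' ∈ S, (openGraph (ω ∩ E₂)).Reachable x y' ↔ (openGraph ((ω ∆ M') ∩ E₂)).Reachable x y')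
      then ω ∆ (M' ∩ E₂) else ω ∆ (M' ∩ (ES ∪ E₂)) := fun ω => rfl
  have hfM : s(o, y) ∈ M' := mem_insert _ _
  have hfB : ∀ X : BondConfig V, s(o, y) ∈ X ∆ M' ↔ s(o, y) ∉ X := fun X => mem_symmDiff_iff_of_mem hfM
  refine fibreCount_eq_of_bij Φ Φ (fun ω hω hA hB => ?_) (fun ω hω hA hB => ?_)
  · -- bad ↦ good
    obtain ⟨hF, he, hf⟩ := hA
    have hF' : IsForestCfg ω := hF
    have hFB : IsForestCfg (ω ∆ M') := hB
    obtain ⟨hfib, hF1, hF2, hinv, hE1, hE2⟩ :=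
      forest_pair_transfer_of_sepTrace h₁ h₂ hES hS hd hd₁ hd₂ hsub hH Φ hΦ hω hF' hFB
    refine ⟨hfib, ⟨hF1, (hE1 _ heE).2 he⟩, ⟨hF2, ?_⟩, hinv⟩
    show s(o, y) ∈ (Φ ω) ∆ M'
    rw [hfB, hE2 _ hfM hfE, not_not]; exact hf
  · -- good ↦ bad
    obtain ⟨hF, he⟩ := hA
    obtain ⟨hFB, hf⟩ := hB
    have hF' : IsForestCfg ω := hF
    have hFB' : IsForestCfg (ω ∆ M') := hFB
    obtain ⟨hfib, hF1, hF2, hinv, hE1, hE2⟩ :=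
      forest_pair_transfer_of_sepTrace h₁ h₂ hES hS hd hd₁ hd₂ hsub hH Φ hΦ hω hF' hFB'
    have hfω : s(o, y) ∉ ω := (hfB ω).1 hf
    exact ⟨hfib, ⟨hF1, (hE1 _ heE).2 he, (hE2 _ hfM hfE).2 hfω⟩, hF2, hinv⟩

end SepTransfer

end FK

end Summit.CriticalPhenomena.PercolationContinuityZ3.Theorems

end
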